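import Summits.NavierStokesRegularity.FunctionalMining.NoGo.TopEigSaturatingKill
import Summits.NavierStokesRegularity.FunctionalMining.StrainMomentBalance
import Summits.NavierStokesRegularity.FunctionalMining.SpectralMixtureCandidates
import HarnessLib

/-!
# FunctionalMining — K1-Q6 (a): the STATIC RATIO of one datum bounds the mixture constant `κ(ε)`
# from below, and a family with mixture heat price `O(ε^s)` forces the rate exponent `a ≥ γ s`

Search for candidate a priori estimates; no regularity claim. Cell `pub-nsfunc`, census-2 seat
(gen 41), staged as `pub-nsfunc-census-2/lean/mixrate/TopEigStrainMixRateBound.lean` (sha256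
a101daa0190adeee) and filed verbatim by the prove seat (gen 24; declarations byte-identical, except that
the local helper `partialDeriv_fun_sub_const` is renamed `partialDeriv_fun_sub_const_mixRate` and made
`private` for the gate's dedup.fqn-exists lint — the name is taken by `PressureMomentRate.lean`).
Imports the tree's `NoGo/TopEigSaturatingKill.lean` (no-go seat: heat-maximal selections, the
selection production `𝒫_q`, LEMMA S `TopEig.selEulerProduction_sub_heat_le_initialRate`, Lemma 0 (⇒)
`SaturatingLawSup.lowerRate_le`), the tree's `StrainMomentBalance.lean` (the exact one-sided
derivative of `Z_q = ∫|S|^q` along classical solutions,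
`GradientTensor.hasDerivWithinAt_integral_strainSqAt_rpow_unforced`, real `q ≥ 2`) and the dict
seat's `SpectralMixtureCandidates.lean` (the mixtures `F_ε = Φ_q + ε Z_q = topEigStrainMix q ε` and the
rate exponent `TopEigStrainMixRate q a`). Refutation / calibration BOOKKEEPING for CANDIDATE a priori
inequalities; nothing about Navier–Stokes regularity is asserted; NO family is exhibited; no row, no
verdict and no dictionary NUMBER is produced by this file — it types the MECHANISM by which a number
would be certified (door D-K6 (a) of `NOGO.md` §3: "NECESSARILY `κ(ε) → ∞` as `ε ↓ 0` … the informative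
dictionary number is the RATE of `κ(ε)`, and a … evaluation of the static ratio for `F_ε` is a
calibration LOWER bound on `κ(ε)` only").

CONTENT. §1 The derivative of `Z_q` along a classical solution at the INITIAL time in DATUM terms:
`strainMomentNSRate ν q w = qν·V_q(w) − q·XP_q(w) − q·XN_q(w)` with the datum's own pressure
`pressureOf w` (`hasDerivWithinAt_strainMoment_navierStokes_datum`; the solution's pressure differs
from `pressureOf (u a)` by a constant, `pressureOf_eq_pressure_sub_integral`). §2 LEMMA S for the
mixture: `F_ε ∘ u` has a right derivative `R` at the initial time with
`𝒫_q(w; e) − ν T_Φ(w) + ε · strainMomentNSRate ν q w ≤ R` (`TopEig.mix_initialRate_le`), hence Lemma 0 (⇒):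
under `SaturatingLawSup F_ε σ γ κ`, for every admissible datum `w`, heat-maximal selection `e` with
integrable production density and every `ν > 0`,
`P_ε(w; e) − ν H_ε(w) ≤ κ ν^{−γ} (2ℰ w) F_ε(w)^{1+1/σ}` with the ν-FREE datum quantities
`P_ε := 𝒫_q − ε q (XP_q + XN_q)` (`mixSelProduction`) and `H_ε := T_Φ − ε q V_q` (`mixHeat`; `−q V_q ≥ 0`
is the `Z_q` dissipation pairing, so `H_ε ≥ T_Φ` for `q > 2`, `ε ≥ 0`: `heatDissipation_le_mixHeat`)
(`SaturatingLawSup.mixSelProduction_sub_heat_le`). §3 OPTIMISING THE VISCOSITY (`ν := P_ε/(2H_ε)`; at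
the K0 exponents this is the same as optimising the amplitude, the ratio being scale-free): if
`0 < P_ε(w; e)` and `0 < H_ε(w)` then **`P_ε · (P_ε/(2H_ε))^γ ≤ 2κ · (2ℰ w) F_ε(w)^{1+1/σ}`**
(`SaturatingLawSup.mix_static_ratio_le`) — the static ratio of ONE datum is a lower bound on `κ`.
§4 THE DICTIONARY CONSEQUENCE: if `TopEigStrainMixRate q a` (the law for `F_ε` with constant `C ε^{−a}`
on `(0, ε₀]`, K0 exponents, `q ≥ 2`) and for every small `ε` there is an admissible datum with a
heat-maximal selection, production `P_ε ≥ c > 0`, budget `(2ℰ)F_ε^{1+1/σ} ≤ B` and mixture heat price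
`0 < H_ε ≤ D ε^s`, then **`γ s ≤ a`**, `γ = (3q − 3)/(2q − 3)` (`TopEigStrainMixRate.gamma_mul_le`).
So a pen family with `H_ε = O(ε^s)` at a production floor certifies the lower bound `γ s` on the
K1-Q6 (a) number; with `s` free this contains the dict seat's `0 < a` (any `s > 0`). The exponent `s`
of the no-go seat's W18-type families is NOT on record (D-K6 (a): the `Z_q` heat price on an interface
of width `η` "expected `≍ η^{−1}` — UNCHECKED") and is not claimed here.
[ours, bookkeeping; D-K6 (a) calibration sentence, K1-Q6 (a)]
-/

noncomputable section

open MeasureTheory Set Filter Topology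

namespace Summit.NavierStokesRegularity.FunctionalMining

open Literature.Analysis.FunctionSpaces Literature.Analysis.FluidPDE TopEig

variable {d : Type*} [Fintype d] [DecidableEq d]

/-! ## 1. The derivative of `Z_q` along a classical solution, in datum terms -/

/-- The viscous pairing `V_q(w) := ∫ (|S|²)^{q/2−1} ∑ᵢⱼ Sᵢⱼ (∂ᵢ Δw)ⱼ` (`= −`(the `Z_q` dissipation)/q,
non-positive for `q > 2`: `GradientTensor.integral_rpow_mul_sum_strain_laplacian_le`). [ours, bookkeeping] -/
def strainLaplacianPairing (q : ℝ) (w : UnitAddTorus d → EuclideanSpace ℝ d) : ℝ :=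
  ∫ x, torusStrainSqAt w x ^ (q / 2 - 1) * ∑ i, ∑ j,
    (Torus.partialDeriv j w x i + Torus.partialDeriv i w x j) / 2 *
      Torus.partialDeriv i (Torus.laplacian w) x j

/-- The pressure-Hessian pairing `XP_q(w) := ∫ (|S|²)^{q/2−1} ∑ᵢⱼ Sᵢⱼ ∂ᵢ∂ⱼ π_w` with the datum's own
pressure `π_w = pressureOf w`. [ours, bookkeeping] -/
def strainPressurePairing (q : ℝ) (w : UnitAddTorus d → EuclideanSpace ℝ d) : ℝ :=
  ∫ x, torusStrainSqAt w x ^ (q / 2 - 1) * ∑ i, ∑ j,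
    (Torus.partialDeriv j w x i + Torus.partialDeriv i w x j) / 2 *
      Torus.partialDeriv i (Torus.partialDeriv j (pressureOf w)) x

/-- The cubic pairing `XN_q(w) := ∫ (|S|²)^{q/2−1} ∑ᵢⱼ Sᵢⱼ ∑ₖ (∂ᵢw)ₖ (∂ₖw)ⱼ`. [ours, bookkeeping] -/
def strainCubicPairing (q : ℝ) (w : UnitAddTorus d → EuclideanSpace ℝ d) : ℝ :=
  ∫ x, torusStrainSqAt w x ^ (q / 2 - 1) * ∑ i, ∑ j,
    (Torus.partialDeriv j w x i + Torus.partialDeriv i w x j) / 2 *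
      ∑ k, Torus.partialDeriv i w x k * Torus.partialDeriv k w x j

/-- The rate of `Z_q` along Navier–Stokes at the datum `w`, viscosity `ν`:
`qν V_q(w) − q XP_q(w) − q XN_q(w)`. [ours, bookkeeping] -/
def strainMomentNSRate (ν q : ℝ) (w : UnitAddTorus d → EuclideanSpace ℝ d) : ℝ :=
  q * ν * strainLaplacianPairing q w - q * strainPressurePairing q w - q * strainCubicPairing q w

omit [Fintype d] in
/-- Partial derivatives ignore additive constants (private: the fully-qualified name is taken by
`PressureMomentRate.lean`'s pointwise version). [folklore] -/
private theorem partialDeriv_fun_sub_const_mixRate (P : UnitAddTorus d → ℝ) (c : ℝ) (j : d) :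
    Torus.partialDeriv j (fun x => P x - c) = Torus.partialDeriv j P := by
  funext x
  simp only [Torus.partialDeriv, Torus.lineDeriv]
  rw [deriv_sub_const]

/-- **The derivative of `Z_q` at the initial time of a classical solution is `strainMomentNSRate ν q (u a)`**
(real `q ≥ 2`; the solution's pressure at time `a` is `pressureOf (u a)` up to a constant).
[ours, bookkeeping; tree `GradientTensor.hasDerivWithinAt_integral_strainSqAt_rpow_unforced`] -/
theorem hasDerivWithinAt_strainMoment_navierStokes_datum [Nonempty d] {a b ν : ℝ} (hab : a < b)
    {u : ℝ → UnitAddTorus d → EuclideanSpace ℝ d} {p : ℝ → UnitAddTorus d → ℝ}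
    (h : Torus.IsClassicalNSSolutionOn (Icc a b) ν 0 u p) {q : ℝ} (hq : 2 ≤ q) :
    HasDerivWithinAt (fun s => torusStrainMoment q (u s)) (strainMomentNSRate ν q (u a)) (Icc a b) a := by
  have ha : a ∈ Icc a b := left_mem_Icc.2 hab.le
  have hD := GradientTensor.hasDerivWithinAt_integral_strainSqAt_rpow_unforced h hab hq ha
  have hPj : ∀ j, Torus.partialDeriv j (pressureOf (u a)) = Torus.partialDeriv j (p a) := fun j => by
    rw [pressureOf_eq_pressure_sub_integral h hab ha, partialDeriv_fun_sub_const_mixRate]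
  have hXP : strainPressurePairing q (u a) =
      ∫ x, torusStrainSqAt (u a) x ^ (q / 2 - 1) * ∑ i, ∑ j,
        (Torus.partialDeriv j (u a) x i + Torus.partialDeriv i (u a) x j) / 2 *
          Torus.partialDeriv i (Torus.partialDeriv j (p a)) x := by
    simp only [strainPressurePairing, hPj]
  have hF : (fun s => torusStrainMoment q (u s)) = fun s => ∫ x, torusStrainSqAt (u s) x ^ (q / 2) := rfl
  rw [hF]
  convert hD using 1
  rw [strainMomentNSRate, hXP, strainLaplacianPairing, strainCubicPairing]

/-! ## 2. LEMMA S for the mixture `F_ε = Φ_q + ε Z_q`, and Lemma 0 (⇒) -/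

/-- **The mixture production** `P_ε(w; e) := 𝒫_q(w; e) − ε q (XP_q(w) + XN_q(w))` — the `ν`-free part
of the initial rate of `F_ε`. [ours, bookkeeping] -/
def mixSelProduction (q ε : ℝ) (w : UnitAddTorus d → EuclideanSpace ℝ d) (e : UnitAddTorus d → d → ℝ) :
    ℝ :=
  selEulerProduction q w e - ε * (q * strainPressurePairing q w + q * strainCubicPairing q w)

/-- **The mixture heat price** `H_ε(w) := T_Φ(w) − ε q V_q(w)` (`T_Φ = heatDissipation Φ_q`; `−q V_q`
is the `Z_q` dissipation pairing) — the coefficient of `−ν` in the initial rate of `F_ε`.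
[ours, bookkeeping] -/
def mixHeat (q ε : ℝ) (w : UnitAddTorus d → EuclideanSpace ℝ d) : ℝ :=
  heatDissipation (torusTopEigMoment q) w - ε * (q * strainLaplacianPairing q w)

/-- `P_ε − ν H_ε = (𝒫_q − ν T_Φ) + ε · strainMomentNSRate ν q`. [ours, bookkeeping] -/
theorem mixSelProduction_sub_mul_mixHeat (q ε ν : ℝ) (w : UnitAddTorus d → EuclideanSpace ℝ d)
    (e : UnitAddTorus d → d → ℝ) :
    mixSelProduction q ε w e - ν * mixHeat q ε w =
      selEulerProduction q w e - ν * heatDissipation (torusTopEigMoment q) w +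
        ε * strainMomentNSRate ν q w := by
  simp only [mixSelProduction, mixHeat, strainMomentNSRate]
  ring

/-- **The `Z_q` dissipation pairing is non-negative** (`q > 2`): `−q V_q(w) ≥ 0`, so
`T_Φ(w) ≤ H_ε(w)` for `ε ≥ 0`. [ours, bookkeeping; tree viscous sign
`GradientTensor.integral_rpow_mul_sum_strain_laplacian_le`] -/
theorem heatDissipation_le_mixHeat {q ε : ℝ} (hq : 2 < q) (hε : 0 ≤ ε)
    {w : UnitAddTorus d → EuclideanSpace ℝ d} (hw : Torus.IsSmooth w) :
    heatDissipation (torusTopEigMoment q) w ≤ mixHeat q ε w := by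
  have hV := GradientTensor.integral_rpow_mul_sum_strain_laplacian_le hw (r := q / 2 - 1) (by linarith)
  have hI : 0 ≤ ∫ x, torusStrainSqAt w x ^ (q / 2 - 1) * ∑ k, ∑ i, ∑ j,
      ((Torus.partialDeriv k (Torus.partialDeriv j w) x i +
        Torus.partialDeriv k (Torus.partialDeriv i w) x j) / 2) ^ 2 :=
    integral_nonneg fun x => mul_nonneg (Real.rpow_nonneg (torusStrainSqAt_nonneg w x) _)
      (Finset.sum_nonneg fun k _ => Finset.sum_nonneg fun i _ => Finset.sum_nonneg fun j _ => sq_nonneg _)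
  have hV0 : strainLaplacianPairing q w ≤ 0 := by
    unfold strainLaplacianPairing; linarith
  unfold mixHeat
  nlinarith [mul_nonneg hε (by linarith : (0 : ℝ) ≤ q)]

namespace TopEig

variable [Nonempty d]

/-- **LEMMA S for the mixture.** Along a classical solution of the unforced Navier–Stokes equations on
`[a, b]` (`q ≥ 2`), for every heat-maximal selection `e` of the datum `u a` with integrable production
density: `s ↦ F_ε(u s)` has a right derivative `R` within `[a, b]` at `a` with
`𝒫_q(u a; e) − ν T_Φ(u a) + ε · strainMomentNSRate ν q (u a) ≤ R`. [ours, bookkeeping; LEMMA S of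
the tree door + §1] -/
theorem mix_initialRate_le {q ε : ℝ} (hq : 2 ≤ q) {a b ν : ℝ} (hab : a < b)
    {u : ℝ → UnitAddTorus d → EuclideanSpace ℝ d} {p : ℝ → UnitAddTorus d → ℝ}
    (h : Torus.IsClassicalNSSolutionOn (Icc a b) ν 0 u p)
    {e : UnitAddTorus d → d → ℝ} (he : IsHeatMaxSelection (u a) e)
    (hint : Integrable (fun x => q * torusStrainTopEig (u a) x ^ (q - 1) *
      quad (eulerStrainVec (u a) x) (e x)) volume) :
    ∃ R : ℝ, HasDerivWithinAt (fun s => topEigStrainMix q ε (u s)) R (Icc a b) a ∧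
      selEulerProduction q (u a) e - ν * heatDissipation (torusTopEigMoment q) (u a) +
        ε * strainMomentNSRate ν q (u a) ≤ R := by
  obtain ⟨R₁, hR₁, hle⟩ := selEulerProduction_sub_heat_le_initialRate (by linarith) hab h he hint
  have hZ := hasDerivWithinAt_strainMoment_navierStokes_datum hab h hq
  refine ⟨R₁ + ε * strainMomentNSRate ν q (u a), ?_, by linarith⟩
  have hF : (fun s => topEigStrainMix q ε (u s)) =
      fun s => torusTopEigMoment q (u s) + ε * torusStrainMoment q (u s) := rfl
  rw [hF]
  exact hR₁.add (hZ.const_mul ε)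

end TopEig

/-- **Lemma 0 (⇒) for the mixture.** Under `SaturatingLawSup F_ε σ γ κ` on `T³` (`q ≥ 2`): at every
smooth divergence-free zero-mean datum `w`, every heat-maximal selection `e` with integrable production
density and every `ν > 0`, `P_ε(w; e) − ν H_ε(w) ≤ κ ν^{−γ} (2ℰ w) F_ε(w)^{1+1/σ}`.
[ours, bookkeeping; SIEVELD §0 Lemma 0 (⇒), tree `SaturatingLawSup.lowerRate_le`] -/
theorem SaturatingLawSup.mixSelProduction_sub_heat_le {q ε σ γ κ : ℝ} (hq : 2 ≤ q)
    (hd : Fintype.card d = 3) (h : SaturatingLawSup (d := d) (topEigStrainMix q ε) σ γ κ)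
    {ν : ℝ} (hν : 0 < ν) {w : UnitAddTorus d → EuclideanSpace ℝ d} (hw : Torus.IsSmooth w)
    (hdw : Torus.IsDivFree w) (hmean : Torus.HasZeroMean w) {e : UnitAddTorus d → d → ℝ}
    (he : IsHeatMaxSelection w e)
    (hint : Integrable (fun x => q * torusStrainTopEig w x ^ (q - 1) *
      quad (eulerStrainVec w x) (e x)) volume) :
    mixSelProduction q ε w e - ν * mixHeat q ε w ≤
      κ * ν ^ (-γ) * (2 * torusEnstrophy w) * topEigStrainMix q ε w ^ (1 + σ⁻¹) := by
  haveI : Nonempty d := Fintype.card_pos_iff.1 (by omega)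
  rw [mixSelProduction_sub_mul_mixHeat]
  refine h.lowerRate_le hd hν hw hdw hmean fun T hT u p hsol hu0 _ => ?_
  subst hu0
  exact mix_initialRate_le hq hT hsol he hint

/-! ## 3. Optimising the viscosity: the static ratio of one datum bounds `κ` from below -/

/-- **The static ratio of ONE datum is a lower bound on the mixture constant.** Under
`SaturatingLawSup F_ε σ γ κ` on `T³` (`q ≥ 2`), at every admissible datum `w` and heat-maximal selection
`e` (integrable production density) with `0 < P_ε(w; e)` and `0 < H_ε(w)`:
`P_ε · (P_ε / (2 H_ε))^γ ≤ 2κ · (2ℰ w) F_ε(w)^{1+1/σ}` (take `ν := P_ε/(2H_ε)` in §2).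
No sign condition on `σ`, `γ`. [ours, bookkeeping; D-K6 (a) "calibration LOWER bound on κ(ε)"] -/
theorem SaturatingLawSup.mix_static_ratio_le {q ε σ γ κ : ℝ} (hq : 2 ≤ q)
    (hd : Fintype.card d = 3) (h : SaturatingLawSup (d := d) (topEigStrainMix q ε) σ γ κ)
    {w : UnitAddTorus d → EuclideanSpace ℝ d} (hw : Torus.IsSmooth w)
    (hdw : Torus.IsDivFree w) (hmean : Torus.HasZeroMean w) {e : UnitAddTorus d → d → ℝ}
    (he : IsHeatMaxSelection w e)
    (hint : Integrable (fun x => q * torusStrainTopEig w x ^ (q - 1) *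
      quad (eulerStrainVec w x) (e x)) volume)
    (hP : 0 < mixSelProduction q ε w e) (hH : 0 < mixHeat q ε w) :
    mixSelProduction q ε w e * (mixSelProduction q ε w e / (2 * mixHeat q ε w)) ^ γ ≤
      2 * κ * ((2 * torusEnstrophy w) * topEigStrainMix q ε w ^ (1 + σ⁻¹)) := by
  set P := mixSelProduction q ε w e with hPdef
  set H := mixHeat q ε w with hHdef
  set b := (2 * torusEnstrophy w) * topEigStrainMix q ε w ^ (1 + σ⁻¹) with hbdef
  have hν : 0 < P / (2 * H) := div_pos hP (by positivity)
  have h1 := h.mixSelProduction_sub_heat_le hq hd hν hw hdw hmean he hint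
  rw [← hPdef, ← hHdef] at h1
  have h2 : P - P / (2 * H) * H = P / 2 := by field_simp; ring
  rw [h2, Real.rpow_neg hν.le] at h1
  have hpow : 0 < (P / (2 * H)) ^ γ := Real.rpow_pos_of_pos hν γ
  calc P * (P / (2 * H)) ^ γ = P / 2 * (2 * (P / (2 * H)) ^ γ) := by ring
    _ ≤ κ * ((P / (2 * H)) ^ γ)⁻¹ * (2 * torusEnstrophy w) * topEigStrainMix q ε w ^ (1 + σ⁻¹) *
          (2 * (P / (2 * H)) ^ γ) :=
        mul_le_mul_of_nonneg_right h1 (by positivity)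
    _ = 2 * κ * b := by rw [hbdef]; field_simp

/-! ## 4. The dictionary consequence: a family with `H_ε = O(ε^s)` forces `a ≥ γ s` -/

/-- Real-exponent bookkeeping: if `ε^{−δ} ≤ K` for all `ε ∈ (0, ε₂]` then `δ ≤ 0`. [folklore] -/
theorem nonpos_of_rpow_neg_le {δ K ε₂ : ℝ} (hε₂ : 0 < ε₂)
    (h : ∀ ε : ℝ, 0 < ε → ε ≤ ε₂ → ε ^ (-δ) ≤ K) : δ ≤ 0 := by
  by_contra hδ
  push Not at hδ
  set M := |K| + 1 with hM
  have hM0 : 0 < M := by positivity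
  set ε := min ε₂ (M⁻¹ ^ δ⁻¹) with hεdef
  have hMi : 0 < M⁻¹ := inv_pos.2 hM0
  have hε0 : 0 < ε := lt_min hε₂ (Real.rpow_pos_of_pos hMi _)
  have hεle : ε ≤ M⁻¹ ^ δ⁻¹ := min_le_right _ _
  have hpow : ε ^ δ ≤ M⁻¹ := by
    calc ε ^ δ ≤ (M⁻¹ ^ δ⁻¹) ^ δ := Real.rpow_le_rpow hε0.le hεle hδ.le
      _ = M⁻¹ := Real.rpow_inv_rpow hMi.le hδ.ne'
  have hεδ : 0 < ε ^ δ := Real.rpow_pos_of_pos hε0 δ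
  have hge : M ≤ ε ^ (-δ) := by
    rw [Real.rpow_neg hε0.le]
    calc M = (M⁻¹)⁻¹ := (inv_inv M).symm
      _ ≤ (ε ^ δ)⁻¹ := inv_anti₀ hεδ hpow
  have hK : ε ^ (-δ) ≤ K := h ε hε0 (min_le_left _ _)
  have : K < M := by rw [hM]; linarith [le_abs_self K]
  linarith

/-- **K1-Q6 (a): a family with mixture heat price `O(ε^s)` at a production floor forces the rate
exponent `a ≥ γ s`** (`T³`, `q ≥ 2`, K0 exponents `σ = 2q − 3`, `γ = (3q − 3)/(2q − 3)`). Hypotheses: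
the law `TopEigStrainMixRate q a`, and for every `ε ∈ (0, ε₁]` a smooth divergence-free zero-mean datum
`w` with a heat-maximal selection `e` (integrable production density), production `c ≤ P_ε(w; e)`,
budget `(2ℰ w) F_ε(w)^{1+1/σ} ≤ B`, and heat price `0 < H_ε(w) ≤ D ε^s`. NO such family is exhibited
here; the exponent `s` of any concrete family is a pen item. [ours, bookkeeping; D-K6 (a), K1-Q6 (a)] -/
theorem TopEigStrainMixRate.gamma_mul_le {q a s c B D ε₁ : ℝ} (hq : 2 ≤ q)
    (h : TopEigStrainMixRate (d := Fin 3) q a) (hc : 0 < c) (hD : 0 < D) (hε₁ : 0 < ε₁)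
    (hfam : ∀ ε : ℝ, 0 < ε → ε ≤ ε₁ →
      ∃ w : UnitAddTorus (Fin 3) → EuclideanSpace ℝ (Fin 3),
        Torus.IsSmooth w ∧ Torus.IsDivFree w ∧ Torus.HasZeroMean w ∧
        ∃ e : UnitAddTorus (Fin 3) → Fin 3 → ℝ, IsHeatMaxSelection w e ∧
          Integrable (fun x => q * torusStrainTopEig w x ^ (q - 1) *
            quad (eulerStrainVec w x) (e x)) volume ∧
          c ≤ mixSelProduction q ε w e ∧
          2 * torusEnstrophy w * topEigStrainMix q ε w ^ (1 + (2 * q - 3)⁻¹) ≤ B ∧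
          0 < mixHeat q ε w ∧ mixHeat q ε w ≤ D * ε ^ s) :
    (3 * q - 3) / (2 * q - 3) * s ≤ a := by
  set γ := (3 * q - 3) / (2 * q - 3) with hγdef
  have hγ0 : 0 < γ := div_pos (by linarith) (by linarith)
  obtain ⟨C, ε₀, hε₀, hlaw⟩ := h
  -- the uniform bound `ε^{−(γ s − a)} ≤ K` on `(0, min ε₀ ε₁]`
  set K := 2 * |C| * |B| * (2 * D) ^ γ / c ^ (1 + γ) with hKdef
  have hcγ : 0 < c ^ (1 + γ) := Real.rpow_pos_of_pos hc _
  suffices hbd : ∀ ε : ℝ, 0 < ε → ε ≤ min ε₀ ε₁ → ε ^ (-(γ * s - a)) ≤ K by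
    have := nonpos_of_rpow_neg_le (lt_min hε₀ hε₁) hbd
    linarith
  intro ε hε hεle
  obtain ⟨w, hw, hdw, hmean, e, he, hint, hcP, hbB, hH, hHD⟩ :=
    hfam ε hε (hεle.trans (min_le_right _ _))
  have hmem := (hlaw ε hε (hεle.trans (min_le_left _ _))).mix_static_ratio_le hq (by simp) hw hdw
    hmean he hint (hc.trans_le hcP) hH
  set P := mixSelProduction q ε w e with hPdef
  set H := mixHeat q ε w with hHdef
  set b := 2 * torusEnstrophy w * topEigStrainMix q ε w ^ (1 + (2 * q - 3)⁻¹) with hbdef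
  have hP : 0 < P := hc.trans_le hcP
  -- lower bound of the left side: `c (c/(2Dε^s))^γ ≤ P (P/(2H))^γ`
  have hεs : 0 < ε ^ s := Real.rpow_pos_of_pos hε s
  have h2H : 0 < 2 * H := by positivity
  have hratio : c / (2 * D * ε ^ s) ≤ P / (2 * H) := by
    rw [div_le_div_iff₀ (by positivity) h2H]
    calc c * (2 * H) ≤ c * (2 * (D * ε ^ s)) := by gcongr
      _ = P * (2 * D * ε ^ s) - (P - c) * (2 * D * ε ^ s) := by ring
      _ ≤ P * (2 * D * ε ^ s) := by
          have : 0 ≤ (P - c) * (2 * D * ε ^ s) := mul_nonneg (by linarith) (by positivity)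
          linarith
  have hcr : 0 < c / (2 * D * ε ^ s) := by positivity
  have hlow : c * (c / (2 * D * ε ^ s)) ^ γ ≤ P * (P / (2 * H)) ^ γ :=
    mul_le_mul hcP (Real.rpow_le_rpow hcr.le hratio hγ0.le)
      (Real.rpow_nonneg hcr.le _) hP.le
  -- upper bound of the right side: `2 κ b ≤ 2 |C| ε^{−a} |B|`
  have hb0 : 0 ≤ b := mul_nonneg (mul_nonneg two_pos.le (torusEnstrophy_nonneg w))
    (Real.rpow_nonneg (topEigStrainMix_nonneg hε.le w) _)
  have hεa : 0 < ε ^ (-a) := Real.rpow_pos_of_pos hε _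
  have hup : 2 * (C * ε ^ (-a)) * b ≤ 2 * (|C| * ε ^ (-a)) * |B| := by
    calc 2 * (C * ε ^ (-a)) * b ≤ 2 * (|C| * ε ^ (-a)) * b := by
          gcongr; exact le_abs_self C
      _ ≤ 2 * (|C| * ε ^ (-a)) * |B| := by
          gcongr; exact hbB.trans (le_abs_self B)
  have hchain : c * (c / (2 * D * ε ^ s)) ^ γ ≤ 2 * (|C| * ε ^ (-a)) * |B| :=
    hlow.trans (hmem.trans hup)
  -- rewrite `c (c/(2Dε^s))^γ = c^{1+γ} (2D)^{−γ} ε^{−γ s}`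
  have hsplit : c * (c / (2 * D * ε ^ s)) ^ γ = c ^ (1 + γ) / (2 * D) ^ γ * ε ^ (-(γ * s)) := by
    rw [Real.div_rpow hc.le (by positivity), Real.mul_rpow (by positivity) hεs.le,
      ← Real.rpow_mul hε.le, Real.rpow_add hc, Real.rpow_one, Real.rpow_neg hε.le,
      show s * γ = γ * s from mul_comm _ _]
    field_simp
  rw [hsplit] at hchain
  -- conclude `ε^{−(γ s − a)} ≤ K`
  have h2D : 0 < (2 * D) ^ γ := Real.rpow_pos_of_pos (by positivity) _
  have hK' : c ^ (1 + γ) / (2 * D) ^ γ * ε ^ (-(γ * s)) * ε ^ a ≤ 2 * |C| * |B| := by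
    have := mul_le_mul_of_nonneg_right hchain (Real.rpow_nonneg hε.le a)
    calc c ^ (1 + γ) / (2 * D) ^ γ * ε ^ (-(γ * s)) * ε ^ a
        ≤ 2 * (|C| * ε ^ (-a)) * |B| * ε ^ a := this
      _ = 2 * |C| * |B| * (ε ^ (-a) * ε ^ a) := by ring
      _ = 2 * |C| * |B| := by rw [Real.rpow_neg hε.le, inv_mul_cancel₀ (Real.rpow_pos_of_pos hε a).ne', mul_one]
  have hexp : ε ^ (-(γ * s - a)) = ε ^ (-(γ * s)) * ε ^ a := by
    rw [← Real.rpow_add hε]; congr 1; ring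
  rw [hexp, hKdef, le_div_iff₀ hcγ]
  have := mul_le_mul_of_nonneg_left hK' (le_of_lt (div_pos h2D hcγ))
  calc ε ^ (-(γ * s)) * ε ^ a * c ^ (1 + γ)
      = (2 * D) ^ γ * (c ^ (1 + γ) / (2 * D) ^ γ * ε ^ (-(γ * s)) * ε ^ a) := by
        field_simp
    _ ≤ (2 * D) ^ γ * (2 * |C| * |B|) := mul_le_mul_of_nonneg_left hK' h2D.le
    _ = 2 * |C| * |B| * (2 * D) ^ γ := by ring

end Summit.NavierStokesRegularity.FunctionalMining

end
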